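import Mathlib
import Literature.LinearAlgebra.Matrix.StieltjesMatrixProofs
import Summits.AtomisticToContinuum.BoseEinsteinCondensation.Theses.BECStoquasticCensoring

/-!
# Route `BECStoquasticCensoring` — support item `StoquasticSchurComplement`
(stmt-AtomisticToContinuum-11480)

Closes the exact signature of
`Summit.AtomisticToContinuum.BoseEinsteinCondensation.Theses.BECStoquasticCensoring.StoquasticSchurComplement`:
for a real symmetric positive-semidefinite Z-matrix `A` with `ker A = ℝψ`, `ψ > 0` entrywise, and a
proper nonempty index split `P = {p}`, `Q = {¬p}`:

1. the principal block `A_QQ` is positive definite;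
2. `A_QQ⁻¹ ≥ 0` entrywise (Stieltjes matrices are inverse-positive,
   `Literature.LinearAlgebra.Matrix.posDef_isZMatrix_inv_nonneg`, Berman–Plemmons Ch. 6 Thm. 2.3);
3. the Schur complement `S = A_PP − A_PQ A_QQ⁻¹ A_QP` is positive semidefinite
   (Mathlib `Matrix.PosDef.fromBlocks₂₂`);
4. `S` is a Z-matrix (`S_ij ≤ A_ij ≤ 0` off the diagonal, since `A_PQ ≤ 0`, `A_QQ⁻¹ ≥ 0`,
   `A_QP ≤ 0`);
5. `ker S = ℝ·ψ|_P` (`(x, −A_QQ⁻¹A_QP x) ∈ ker A ⇔ S x = 0`);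
6. `ψ|_Q = −A_QQ⁻¹ A_QP ψ|_P` (the `Q`-rows of `Aψ = 0`).

The proof is first carried out for an honest block matrix `fromBlocks APP APQ AQP AQQ`
(`StoquasticSchurComplement.blocks`) and then transported along `Equiv.sumCompl p`.

References: C. D. Meyer, *Stochastic complementation…*, SIAM Rev. 31 (1989) [Meyer1989];
A. Berman, R. J. Plemmons, *Nonnegative Matrices in the Mathematical Sciences* (1979/1994), Ch. 6
[BermanPlemmons1994].
-/

namespace Summit.AtomisticToContinuum.BoseEinsteinCondensation.Theorems

open Matrix Literature.LinearAlgebra.Matrix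

namespace StoquasticSchurComplement

variable {P Q : Type*} [Fintype P] [Fintype Q] [DecidableEq Q]

/-- For a real positive-semidefinite matrix, `xᵀ M x = 0` forces `M x = 0` (real specialisation of
`Matrix.PosSemidef.dotProduct_mulVec_zero_iff`). [folklore] -/
theorem mulVec_eq_zero_of_dotProduct_eq_zero {n : Type*} [Fintype n] {M : Matrix n n ℝ}
    (hM : M.PosSemidef) (x : n → ℝ) (h : x ⬝ᵥ (M *ᵥ x) = 0) : M *ᵥ x = 0 := by
  have h' : star x ⬝ᵥ (M *ᵥ x) = 0 := by simpa using h
  exact (hM.dotProduct_mulVec_zero_iff x).mp h'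

/-- **Block form of the stoquastic Schur complement theorem.** For a real symmetric
positive-semidefinite Z-matrix in block form `M = [[APP, APQ], [AQP, AQQ]]` whose kernel is the line
spanned by an entrywise positive vector `(ψP, ψQ)`, with both blocks nonempty: `AQQ ≻ 0`,
`AQQ⁻¹ ≥ 0`, the Schur complement `APP − APQ AQQ⁻¹ AQP` is a positive-semidefinite Z-matrix with
kernel `ℝ ψP`, and `ψQ = −AQQ⁻¹ AQP ψP`. [cite: BermanPlemmons1994, Ch. 6, Thm. 4.16 and Ex. 5.8;
Meyer1989, Thm. 2.1–2.3] -/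
theorem blocks [Nonempty P] [Nonempty Q] (APP : Matrix P P ℝ) (APQ : Matrix P Q ℝ)
    (AQP : Matrix Q P ℝ) (AQQ : Matrix Q Q ℝ) (ψP : P → ℝ) (ψQ : Q → ℝ)
    (hA : (fromBlocks APP APQ AQP AQQ).PosSemidef)
    (hZ : IsZMatrix (fromBlocks APP APQ AQP AQQ))
    (hψP : ∀ i, 0 < ψP i)
    (hker : ∀ v : P ⊕ Q → ℝ,
      (fromBlocks APP APQ AQP AQQ) *ᵥ v = 0 ↔ ∃ t : ℝ, v = t • Sum.elim ψP ψQ) :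
    AQQ.PosDef ∧ (∀ i j, 0 ≤ AQQ⁻¹ i j) ∧ (APP - APQ * AQQ⁻¹ * AQP).PosSemidef ∧
      IsZMatrix (APP - APQ * AQQ⁻¹ * AQP) ∧
      (∀ x : P → ℝ, (APP - APQ * AQQ⁻¹ * AQP) *ᵥ x = 0 ↔ ∃ t : ℝ, x = t • ψP) ∧
      ψQ = -((AQQ⁻¹ * AQP) *ᵥ ψP) := by
  -- Hermitian structure of the blocks
  have hH := isHermitian_fromBlocks_iff.mp hA.1
  have hQQh : AQQ.IsHermitian := hH.2.2.2
  have hAQP : APQᴴ = AQP := hH.2.1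
  -- block action of `M` on `Sum.elim x y`
  have hmul : ∀ (x : P → ℝ) (y : Q → ℝ), (fromBlocks APP APQ AQP AQQ) *ᵥ Sum.elim x y =
      Sum.elim (APP *ᵥ x + APQ *ᵥ y) (AQP *ᵥ x + AQQ *ᵥ y) := by
    intro x y
    rw [fromBlocks_mulVec]
    rfl
  -- (1) `AQQ` is positive definite
  have hQQ : AQQ.PosDef := by
    refine PosDef.of_dotProduct_mulVec_pos hQQh fun x hx => ?_
    have hv : star (Sum.elim (0 : P → ℝ) x) ⬝ᵥ ((fromBlocks APP APQ AQP AQQ) *ᵥ Sum.elim 0 x) =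
        x ⬝ᵥ (AQQ *ᵥ x) := by
      rw [star_trivial, hmul, sumElim_dotProduct_sumElim]
      simp
    have h0 : 0 ≤ x ⬝ᵥ (AQQ *ᵥ x) := by
      rw [← hv]
      exact hA.dotProduct_mulVec_nonneg _
    rw [star_trivial]
    refine lt_of_le_of_ne h0 fun heq => hx ?_
    -- if the form vanishes, `(0, x)` lies in the kernel, hence is a multiple of `ψ`, hence zero
    have hz : (fromBlocks APP APQ AQP AQQ) *ᵥ Sum.elim 0 x = 0 := by
      apply mulVec_eq_zero_of_dotProduct_eq_zero hA
      rw [← heq.symm, ← hv, star_trivial]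
    obtain ⟨t, ht⟩ := (hker _).mp hz
    obtain ⟨i₀⟩ := ‹Nonempty P›
    have hti : (0 : ℝ) = t * ψP i₀ := by
      have := congrFun ht (Sum.inl i₀)
      simpa using this
    have ht0 : t = 0 := by
      rcases mul_eq_zero.mp hti.symm with h | h
      · exact h
      · exact absurd h (hψP i₀).ne'
    funext j
    have := congrFun ht (Sum.inr j)
    simpa [ht0] using this
  have hdet : IsUnit AQQ.det := (isUnit_iff_isUnit_det AQQ).mp hQQ.isUnit
  -- (2) `AQQ⁻¹ ≥ 0`
  have hZQQ : IsZMatrix AQQ := by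
    intro i j hij
    have := hZ (Sum.inr i) (Sum.inr j) (by simpa using hij)
    simpa using this
  have hinv : ∀ i j, 0 ≤ AQQ⁻¹ i j := posDef_isZMatrix_inv_nonneg hQQ hZQQ
  -- (3) the Schur complement is positive semidefinite
  have hS : (APP - APQ * AQQ⁻¹ * AQP).PosSemidef := by
    letI : Invertible AQQ := hQQ.isUnit.invertible
    have h := (PosDef.fromBlocks₂₂ APP APQ hQQ).mp (by rw [hAQP]; exact hA)
    rwa [hAQP] at h
  -- (4) the Schur complement is a Z-matrix
  have hZS : IsZMatrix (APP - APQ * AQQ⁻¹ * AQP) := by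
    intro i j hij
    have hPP : APP i j ≤ 0 := by
      have := hZ (Sum.inl i) (Sum.inl j) (by simpa using hij)
      simpa using this
    have hcorr : 0 ≤ (APQ * AQQ⁻¹ * AQP) i j := by
      rw [mul_apply]
      refine Finset.sum_nonneg fun k _ => mul_nonneg_of_nonpos_of_nonpos ?_ ?_
      · rw [mul_apply]
        refine Finset.sum_nonpos fun l _ => mul_nonpos_of_nonpos_of_nonneg ?_ (hinv l k)
        have := hZ (Sum.inl i) (Sum.inr l) (by simp)
        simpa using this
      · have := hZ (Sum.inr k) (Sum.inl j) (by simp)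
        simpa using this
    rw [Matrix.sub_apply]
    linarith
  -- (6) harmonic extension: the `Q`-rows of `M ψ = 0`
  have hψker : (fromBlocks APP APQ AQP AQQ) *ᵥ Sum.elim ψP ψQ = 0 :=
    (hker _).mpr ⟨1, by rw [one_smul]⟩
  have hext : ψQ = -((AQQ⁻¹ * AQP) *ᵥ ψP) := by
    have hrow : AQP *ᵥ ψP + AQQ *ᵥ ψQ = 0 := by
      have := congrArg (fun w => w ∘ Sum.inr) hψker
      simpa [hmul] using this
    have hQ : AQQ *ᵥ ψQ = -(AQP *ᵥ ψP) := eq_neg_of_add_eq_zero_right hrow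
    calc ψQ = AQQ⁻¹ *ᵥ (AQQ *ᵥ ψQ) := by rw [mulVec_mulVec, nonsing_inv_mul _ hdet, one_mulVec]
      _ = -((AQQ⁻¹ * AQP) *ᵥ ψP) := by rw [hQ, mulVec_neg, mulVec_mulVec]
  -- (5) kernel of the Schur complement
  have hlift : ∀ x : P → ℝ, (fromBlocks APP APQ AQP AQQ) *ᵥ Sum.elim x (-((AQQ⁻¹ * AQP) *ᵥ x)) =
      Sum.elim ((APP - APQ * AQQ⁻¹ * AQP) *ᵥ x) 0 := by
    intro x
    rw [hmul]
    congr 1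
    · rw [sub_mulVec]
      simp only [mulVec_neg, ← mulVec_mulVec, sub_eq_add_neg]
    · rw [mulVec_neg, mulVec_mulVec, mul_nonsing_inv_cancel_left _ _ hdet, add_neg_cancel]
  have hSψ : (APP - APQ * AQQ⁻¹ * AQP) *ᵥ ψP = 0 := by
    have h := hlift ψP
    rw [← hext, hψker] at h
    have := congrArg (fun w => w ∘ Sum.inl) h
    simpa using this.symm
  have hkerS : ∀ x : P → ℝ, (APP - APQ * AQQ⁻¹ * AQP) *ᵥ x = 0 ↔ ∃ t : ℝ, x = t • ψP := by
    intro x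
    constructor
    · intro hx
      have hz : (fromBlocks APP APQ AQP AQQ) *ᵥ Sum.elim x (-((AQQ⁻¹ * AQP) *ᵥ x)) = 0 := by
        rw [hlift, hx]
        funext i
        cases i <;> rfl
      obtain ⟨t, ht⟩ := (hker _).mp hz
      refine ⟨t, ?_⟩
      funext i
      have := congrFun ht (Sum.inl i)
      simpa using this
    · rintro ⟨t, rfl⟩
      rw [mulVec_smul, hSψ, smul_zero]
  exact ⟨hQQ, hinv, hS, hZS, hkerS, hext⟩

end StoquasticSchurComplement

open StoquasticSchurComplement in
/-- **Stoquastic Schur complement** (closes stmt-AtomisticToContinuum-11480): for a real symmetric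
positive-semidefinite Z-matrix `A` with `ker A = ℝψ`, `ψ > 0`, and a proper nonempty index split
`P = {p}`, `Q = {¬p}`: `A_QQ ≻ 0` with `A_QQ⁻¹ ≥ 0`, the Schur complement onto `P` is a
positive-semidefinite Z-matrix with kernel `ℝ·ψ|_P`, and `ψ|_Q = −A_QQ⁻¹A_QPψ|_P`.
[cite: BermanPlemmons1994, Ch. 6, Thm. 4.16, Ex. 5.8; Meyer1989] -/
theorem stoquasticSchurComplement_proof :
    Summit.AtomisticToContinuum.BoseEinsteinCondensation.Theses.BECStoquasticCensoring.StoquasticSchurComplement := by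
  intro n _ _ A ψ p _ hA hZ hψ hker hP hQ
  -- block reindexing along `P ⊕ Q ≃ n`
  set e : {i // p i} ⊕ {i // ¬ p i} ≃ n := Equiv.sumCompl p with he
  set APP : Matrix {i // p i} {i // p i} ℝ := A.submatrix Subtype.val Subtype.val with hAPP
  set APQ : Matrix {i // p i} {i // ¬ p i} ℝ := A.submatrix Subtype.val Subtype.val with hAPQ
  set AQP : Matrix {i // ¬ p i} {i // p i} ℝ := A.submatrix Subtype.val Subtype.val with hAQP
  set AQQ : Matrix {i // ¬ p i} {i // ¬ p i} ℝ := A.submatrix Subtype.val Subtype.val with hAQQ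
  set ψP : {i // p i} → ℝ := fun i => ψ i.1 with hψP
  set ψQ : {i // ¬ p i} → ℝ := fun i => ψ i.1 with hψQ
  have hblock : A.submatrix e e = fromBlocks APP APQ AQP AQQ := by
    ext (i | i) (j | j) <;> rfl
  have hψe : ψ ∘ e = Sum.elim ψP ψQ := by
    funext i
    cases i <;> rfl
  haveI : Nonempty {i // p i} := by
    obtain ⟨i, hi⟩ := hP
    exact ⟨⟨i, hi⟩⟩
  haveI : Nonempty {i // ¬ p i} := by
    obtain ⟨i, hi⟩ := hQ
    exact ⟨⟨i, hi⟩⟩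
  have hA' : (fromBlocks APP APQ AQP AQQ).PosSemidef := hblock ▸ hA.submatrix e
  have hZ' : IsZMatrix (fromBlocks APP APQ AQP AQQ) := by
    intro i j hij
    rw [← hblock]
    exact hZ (e i) (e j) (e.injective.ne hij)
  have hψP' : ∀ i, 0 < ψP i := fun i => hψ i.1
  have hker' : ∀ v : {i // p i} ⊕ {i // ¬ p i} → ℝ,
      (fromBlocks APP APQ AQP AQQ) *ᵥ v = 0 ↔ ∃ t : ℝ, v = t • Sum.elim ψP ψQ := by
    intro v
    rw [← hblock, submatrix_mulVec_equiv]
    have h1 : (A *ᵥ (v ∘ e.symm)) ∘ e = 0 ↔ A *ᵥ (v ∘ e.symm) = 0 := by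
      constructor
      · intro h
        funext i
        have := congrFun h (e.symm i)
        simpa using this
      · intro h
        rw [h]
        rfl
    rw [h1, hker]
    refine exists_congr fun t => ?_
    constructor
    · intro h
      have := congrArg (fun w => w ∘ e) h
      simp only [Function.comp_assoc, Equiv.symm_comp_self, Function.comp_id] at this
      rw [this, ← hψe]
      rfl
    · intro h
      rw [h, ← hψe]
      funext i
      simp
  exact blocks APP APQ AQP AQQ ψP ψQ hA' hZ' hψP' hker'

end Summit.AtomisticToContinuum.BoseEinsteinCondensation.Theorems
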